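import Summits.SmoothPoincare4.SmoothPoincare4.Theorems.CongruenceShadowsAgkCor6SufficiencyGeomMarkingDefs

/-!
# Stub `stub_smallJointChartCell` of line `lp-by-sphere-system-surgery` for crux `AgkCor6Sufficiency`
(item stmt-SmoothPoincare4-10894, routes `CongruenceShadows` / `GroupTrisection`; lead reshape r6b)

**Small joint-chart cells.**  The tree's `IsGKTrisection.exists_jointChart_cell`
(`Literature/Topology/FourManifolds/TrisectionStabilizationDatumSphere.lean`) produces, at every
point `x` of the central surface `F = ⋂ m, S m` of a Gay–Kirby trisection, a chart `Θ` of the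
maximal `C^∞` atlas centred at `x` in which all three sectors are linear, together with a
chart-like `2`-cell `Φ` of `F` centred at `x` read linearly in `Θ`.  Here the same package is
produced INSIDE a prescribed open neighbourhood `U ∋ x`: the joint chart of
`IsGKTrisection.exists_jointChart` is first restricted to `U` (`OpenPartialHomeomorph.restr`;
the maximal atlas of the `C^∞` groupoid is closed under restriction, `restr_mem_maximalAtlas`),
which keeps every sector clause (they quantify over the source) and adds `Θ.source ⊆ U`; then
`exists_chartCell_of_chart` is applied to the restricted chart.  No `sorry`.
-/

set_option linter.dupNamespace false

noncomputable section

open Set Function ContinuousMap Metric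
open scoped Manifold ContDiff Topology

namespace Summit.SmoothPoincare4.SmoothPoincare4.Cruxes.AgkCor6Sufficiency.LpBySphereSystemSurgery

open Literature.Topology.FourManifolds

/-- **Small joint-chart cells of the central surface.**  For a Gay–Kirby trisection `S` of the
smooth `4`-manifold `X`, sectors `S i`, `S j` (`j ≠ i`), a point `x` of the central surface
`⋂ m, S m` and an open neighbourhood `U` of `x`, there are a chart `Θ` of the maximal `C^∞` atlas
centred at `x` WITH `Θ.source ⊆ U` in which `S i = {q₀ ≥ 0, q₁ ≥ 0}`, `S j = {q₀ ≤ 0, q₀ ≤ q₁}`,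
`S l = {q₁ ≤ 0, q₁ ≤ q₀}` and `⋂ m, S m = {q₀ = q₁ = 0}`, and a chart-like `2`-cell
`Φ(z) = Θ⁻¹(0, 0, ρ z)` (`z ∈ B̄(0, 2) ⊂ ℝ²`, `ρ > 0`) of the central surface centred at `x` with
`(⋂ m, S m) ∩ O = Φ(B(0, 2))` for the open `O = {y ∈ Θ.source | ‖(Θ y)₂₃‖ < 2ρ} ∋ x`
(`IsGKTrisection.exists_jointChart` restricted to `U`, then `exists_chartCell_of_chart`). -/
theorem stub_smallJointChartCell {X : Type} [TopologicalSpace X] [T2Space X]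
    [ChartedSpace (EuclideanSpace ℝ (Fin 4)) X] [IsManifold (𝓡 4) ∞ X]
    {g : ℕ} {k : Fin 3 → ℕ} {S : Fin 3 → Set X} (h : IsGKTrisection X g k S) {i j : Fin 3}
    (hji : j ≠ i) {x : X} (hx : x ∈ ⋂ l, S l) {U : Set X} (hU : IsOpen U) (hxU : x ∈ U) :
    ∃ (Θ : OpenPartialHomeomorph X (EuclideanSpace ℝ (Fin 4))) (l : Fin 3) (ρ : ℝ)
      (Φ : C(closedBall (0 : EuclideanSpace ℝ (Fin 2)) 2, X)) (O : Set X),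
      Θ ∈ IsManifold.maximalAtlas (𝓡 4) ∞ X ∧ x ∈ Θ.source ∧ Θ x = 0 ∧ l ≠ i ∧ l ≠ j ∧
      (∀ y ∈ Θ.source, y ∈ S i ↔ (0 ≤ Θ y 0 ∧ 0 ≤ Θ y 1)) ∧
      (∀ y ∈ Θ.source, y ∈ (⋂ m, S m) ↔ (Θ y 0 = 0 ∧ Θ y 1 = 0)) ∧
      (∀ y ∈ Θ.source, y ∈ S j ↔ (Θ y 0 ≤ 0 ∧ Θ y 0 ≤ Θ y 1)) ∧
      (∀ y ∈ Θ.source, y ∈ S l ↔ (Θ y 1 ≤ 0 ∧ Θ y 1 ≤ Θ y 0)) ∧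
      0 < ρ ∧ (∀ z, Φ z ∈ Θ.source) ∧
      (∀ z, Θ (Φ z) =
        !₂[0, 0, ρ * (z : EuclideanSpace ℝ (Fin 2)) 0, ρ * (z : EuclideanSpace ℝ (Fin 2)) 1]) ∧
      Φ ⟨0, by simp⟩ = x ∧ Injective Φ ∧ range Φ ⊆ (⋂ m, S m) ∧ IsOpen O ∧ O ⊆ Θ.source ∧ x ∈ O ∧
      O = {y | y ∈ Θ.source ∧ ‖(!₂[Θ y 2, Θ y 3] : EuclideanSpace ℝ (Fin 2))‖ < 2 * ρ} ∧
      (⋂ m, S m) ∩ O = Φ '' {z | ‖(z : EuclideanSpace ℝ (Fin 2))‖ < 2} ∧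
      Θ.source ⊆ U := by
  obtain ⟨Θ, l, hΘ, hxs, hΘx, hli, hlj, hSi, hF, hSj, hSl⟩ := h.exists_jointChart hji hx
  -- restrict the joint chart to `U`
  have hsrc : (Θ.restr U).source = Θ.source ∩ U := Θ.restr_source' U hU
  have hΘ' : Θ.restr U ∈ IsManifold.maximalAtlas (𝓡 4) ∞ X :=
    restr_mem_maximalAtlas (contDiffGroupoid ∞ (𝓡 4)) hΘ hU
  have hxs' : x ∈ (Θ.restr U).source := hsrc ▸ ⟨hxs, hxU⟩
  have hΘx' : Θ.restr U x = 0 := by rw [OpenPartialHomeomorph.restr_apply]; exact hΘx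
  have hmem : ∀ y ∈ (Θ.restr U).source, y ∈ Θ.source := fun y hy => (hsrc ▸ hy : y ∈ _ ∩ U).1
  have hSi' : ∀ y ∈ (Θ.restr U).source, y ∈ S i ↔ (0 ≤ Θ.restr U y 0 ∧ 0 ≤ Θ.restr U y 1) :=
    fun y hy => by rw [OpenPartialHomeomorph.restr_apply]; exact hSi y (hmem y hy)
  have hF' : ∀ y ∈ (Θ.restr U).source,
      y ∈ (⋂ m, S m) ↔ (Θ.restr U y 0 = 0 ∧ Θ.restr U y 1 = 0) :=
    fun y hy => by rw [OpenPartialHomeomorph.restr_apply]; exact hF y (hmem y hy)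
  have hSj' : ∀ y ∈ (Θ.restr U).source,
      y ∈ S j ↔ (Θ.restr U y 0 ≤ 0 ∧ Θ.restr U y 0 ≤ Θ.restr U y 1) :=
    fun y hy => by rw [OpenPartialHomeomorph.restr_apply]; exact hSj y (hmem y hy)
  have hSl' : ∀ y ∈ (Θ.restr U).source,
      y ∈ S l ↔ (Θ.restr U y 1 ≤ 0 ∧ Θ.restr U y 1 ≤ Θ.restr U y 0) :=
    fun y hy => by rw [OpenPartialHomeomorph.restr_apply]; exact hSl y (hmem y hy)
  obtain ⟨ρ, Φ, O, hρ, h1, h2, h3, h4, h5, h6, h7, h8, h9, h10⟩ :=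
    exists_chartCell_of_chart (Θ.restr U) hxs' hΘx' hF'
  exact ⟨Θ.restr U, l, ρ, Φ, O, hΘ', hxs', hΘx', hli, hlj, hSi', hF', hSj', hSl', hρ, h1, h2, h3,
    h4, h5, h6, h7, h8, h9, h10, fun y hy => (hsrc ▸ hy : y ∈ _ ∩ U).2⟩

end Summit.SmoothPoincare4.SmoothPoincare4.Cruxes.AgkCor6Sufficiency.LpBySphereSystemSurgery
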